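import Mathlib.MeasureTheory.Integral.IntervalIntegral.FundThmCalculus
import Literature.Analysis.FluidPDE.DissipativeEulerReynolds
import Literature.Analysis.FluidPDE.EulerReynoldsTestedIdentities
import Literature.Analysis.FluidPDE.GloballyDissipativeEulerLimit
import Literature.Analysis.FluidPDE.GloballyDissipativeEulerEnergy
import HarnessLib

/-!
# De Lellis–Kwon 2022, Thm. 1.1: the passage from the iteration to globally dissipative Euler
# flows with strict energy loss (§2.2–2.3 of the printed proof, assembled)

Proofs file for the named fact `Torus.DeLellisKwon2022_thm11` (`GloballyDissipativeEuler`;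
De Lellis–Kwon, Anal. PDE 15 (2022) = arXiv:2006.06482, Thm. 1.1). The printed proof has two
parts: the **iteration** (Prop. 2.3, §§3–11: from a dissipative Euler–Reynolds flow
`(v_q, p_q, R_q, κ_q, φ_q)` with energy loss `E` produce the next one with smaller errors and
controlled increments) started from the explicit tuple of §2.3, and the **limit step** (§2.2–2.3):
the `v_q` converge uniformly (indeed in `C⁰_t C^β_x`) to a Hölder field `v`, the errors
`(R_q, κ_q, φ_q) → 0` uniformly, the limit `(v, p)` is a globally dissipative Euler flow, and
testing its local energy balance `∂ₜ(½|v|²) + ∇·((½|v|² + p)v) = E'/2` with functions of time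
alone gives `∫½|v|²(T) - ∫½|v|²(0) = (E(T) - E(0))/2 < 0`, i.e. (Onsager).

This file proves the limit step in full, for dissipative Euler–Reynolds flows in the sense of
`Torus.IsDissipativeEulerReynoldsOn` (Def. 2.1):

* `Torus.IsDissipativeEulerReynoldsOn.unifLimit_isGloballyDissipativeEulerOn` — uniform limits
  with vanishing errors and `E' ≤ 0` are globally dissipative Euler flows, with local energy
  balance of defect `-E'/2`;
* `Torus.IsDissipativeEulerReynoldsOn.unifLimit_kineticEnergy_sub` — for such limits
  `½∫|u(T)|² - ½∫|u(0)|² = (E(T) - E(0))/2`;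
* `Torus.deLellisKwon2022_thm11_witness_of_iteration` — hence, if the limit velocity is moreover
  `C^β` on `[0,T] × T^d` and `E(T) < E(0)`, it witnesses the conclusion of
  `Torus.DeLellisKwon2022_thm11` for this `β` and `T`.

What is **not** here is the iteration itself (DLK Prop. 2.3 with the starting tuple and parameter
choice of §2.3, and the interpolation bookkeeping turning the increment bounds (2.10) into
uniform convergence and Hölder regularity of the limit): `Torus.DeLellisKwon2022_thm11` follows
from `Torus.deLellisKwon2022_thm11_witness_of_iteration` as soon as, for every `β < 1/7` and
`T > 0`, such a convergent sequence is supplied.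

## References

* C. De Lellis, H. Kwon, *On nonuniqueness of Hölder continuous globally dissipative Euler
  flows*, Anal. PDE 15 (2022) 2003–2059 = arXiv:2006.06482, Def. 2.1, Prop. 2.3, §2.2, §2.3,
  Thm. 1.1. [DelellisKwon2022]
-/

noncomputable section

open MeasureTheory Set Filter Function
open scoped InnerProductSpace RealInnerProductSpace ENNReal NNReal Topology

namespace Literature.Analysis.FluidPDE.Torus

variable {d : Type*} [Fintype d] [DecidableEq d]

/-- **Uniform limits of dissipative Euler–Reynolds flows with vanishing errors are globally
dissipative Euler flows** (De Lellis–Kwon 2022, §2.2–2.3: "Since `(R_q, κ_q, φ_q)` converges to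
`0` in `C⁰([0,T] × T³)`, the limit `(v,p)` solves the Euler equation and satisfies" the local
energy balance with right-hand side `E'/2` "in the distributional sense"). If
`(v_q, p_q, R_q, κ_q, φ_q)` are dissipative Euler–Reynolds flows on `[0,T] × T^d` (Def. 2.1) with a
common energy loss `E`, `E' ≤ 0` on `[0,T]`, `v_q → u` and `p_q → P` uniformly and
`R_q, κ_q, φ_q → 0` uniformly, then `(u, P)` is a globally dissipative Euler flow on
`[0,T] × T^d` and, for every scalar test `ψ` compactly supported in `(0,T)`,
`∫∫ ½|u|²∂ₜψ + (½|u|² + P)⟪u,∇ψ⟫ = ∫₀ᵀ (-E'(t)/2) ∫ψ(t,·) dt`. Proof: the tested identities of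
each flow (`Torus.momentum_testedIdentity`, `Torus.localEnergy_testedIdentity`) pass to the
limit (`Torus.isGloballyDissipativeEulerOn_of_unifLimit`). [cite: DelellisKwon2022, §2.2–2.3] -/
theorem IsDissipativeEulerReynoldsOn.unifLimit_isGloballyDissipativeEulerOn {T : ℝ} (hT : 0 < T)
    {v : ℕ → ℝ → UnitAddTorus d → EuclideanSpace ℝ d} {p : ℕ → ℝ → UnitAddTorus d → ℝ}
    {R : ℕ → ℝ → UnitAddTorus d → d → EuclideanSpace ℝ d} {κ : ℕ → ℝ → UnitAddTorus d → ℝ}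
    {φ : ℕ → ℝ → UnitAddTorus d → EuclideanSpace ℝ d} {E : ℝ → ℝ}
    {u : ℝ → UnitAddTorus d → EuclideanSpace ℝ d} {P : ℝ → UnitAddTorus d → ℝ}
    (h : ∀ q, IsDissipativeEulerReynoldsOn (Icc 0 T) (v q) (p q) (R q) (κ q) (φ q) E)
    (hE' : ∀ t ∈ Icc 0 T, deriv E t ≤ 0)
    (hv : ∀ ε > (0 : ℝ), ∃ N : ℕ, ∀ q ≥ N, ∀ t ∈ Icc 0 T, ∀ x, ‖v q t x - u t x‖ ≤ ε)
    (hp : ∀ ε > (0 : ℝ), ∃ N : ℕ, ∀ q ≥ N, ∀ t ∈ Icc 0 T, ∀ x, ‖p q t x - P t x‖ ≤ ε)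
    (hR : ∀ ε > (0 : ℝ), ∃ N : ℕ, ∀ q ≥ N, ∀ t ∈ Icc 0 T, ∀ x, ‖R q t x‖ ≤ ε)
    (hκ : ∀ ε > (0 : ℝ), ∃ N : ℕ, ∀ q ≥ N, ∀ t ∈ Icc 0 T, ∀ x, ‖κ q t x‖ ≤ ε)
    (hφ : ∀ ε > (0 : ℝ), ∃ N : ℕ, ∀ q ≥ N, ∀ t ∈ Icc 0 T, ∀ x, ‖φ q t x‖ ≤ ε) :
    IsGloballyDissipativeEulerOn T u P ∧
      ∀ ψ : ℝ → UnitAddTorus d → ℝ, FunctionSpaces.Torus.IsSpaceTimeTestIoo T ψ →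
        ∫ t in Ioo 0 T, ∫ x, (2⁻¹ * ‖u t x‖ ^ 2 * FunctionSpaces.Torus.timeDeriv ψ t x +
            (2⁻¹ * ‖u t x‖ ^ 2 + P t x) * ⟪u t x, FunctionSpaces.Torus.gradient (ψ t) x⟫_ℝ) =
          ∫ t in Ioo 0 T, -(2⁻¹ * deriv E t) * ∫ x, ψ t x := by
  have hE1 : ContDiff ℝ 1 E := (h 0).contDiff_one_energyLoss
  have hD : ContinuousOn (fun t => -(2⁻¹ * deriv E t)) (Icc 0 T) :=
    (continuous_const.mul (hE1.continuous_deriv le_rfl)).neg.continuousOn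
  have hD0 : ∀ t ∈ Icc 0 T, 0 ≤ -(2⁻¹ * deriv E t) := fun t ht => by
    have := hE' t ht
    nlinarith
  exact isGloballyDissipativeEulerOn_of_unifLimit hT (D := fun t => -(2⁻¹ * deriv E t))
    (fun q => (h q).smooth_velocity.continuousOn_stLift)
    (fun q => (h q).smooth_pressure.continuousOn_stLift)
    (fun q => (h q).smooth_stress.continuousOn_stLift)
    (fun q => (h q).smooth_kappa.continuousOn_stLift)
    (fun q => (h q).smooth_current.continuousOn_stLift) hD hD0
    (fun q t ht => (h q).isWeaklyDivFree ht)
    (fun q ψ hψ => momentum_testedIdentity hT subset_rfl (h q).smooth_velocity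
      (h q).smooth_pressure (h q).smooth_stress (h q).momentum (h q).divFree hψ)
    (fun q ψ hψ => localEnergy_testedIdentity hT subset_rfl (h q).smooth_velocity
      (h q).smooth_pressure (h q).smooth_stress (h q).smooth_kappa (h q).smooth_current
      (h q).contDiff_one_energyLoss (h q).divFree (h q).localEnergy hψ)
    hv hp hR hκ hφ

/-- **The total kinetic energy of the limit flow follows the energy loss** (De Lellis–Kwon 2022,
§2.3: "the total kinetic energy ... coincides with `E` up to a constant, namely
`∫½|v|²(T) - ∫½|v|²(0) = E(T) - E(0)`"; on the unit torus with the normalisation `Dₜ(κ + E/2)`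
of Def. 2.1 the constant is `½`). Under the hypotheses of
`unifLimit_isGloballyDissipativeEulerOn`,
`½∫|u(T)|² - ½∫|u(0)|² = (E(T) - E(0))/2`. [cite: DelellisKwon2022, §2.3] -/
theorem IsDissipativeEulerReynoldsOn.unifLimit_kineticEnergy_sub {T : ℝ} (hT : 0 < T)
    {v : ℕ → ℝ → UnitAddTorus d → EuclideanSpace ℝ d} {p : ℕ → ℝ → UnitAddTorus d → ℝ}
    {R : ℕ → ℝ → UnitAddTorus d → d → EuclideanSpace ℝ d} {κ : ℕ → ℝ → UnitAddTorus d → ℝ}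
    {φ : ℕ → ℝ → UnitAddTorus d → EuclideanSpace ℝ d} {E : ℝ → ℝ}
    {u : ℝ → UnitAddTorus d → EuclideanSpace ℝ d} {P : ℝ → UnitAddTorus d → ℝ}
    (h : ∀ q, IsDissipativeEulerReynoldsOn (Icc 0 T) (v q) (p q) (R q) (κ q) (φ q) E)
    (hE' : ∀ t ∈ Icc 0 T, deriv E t ≤ 0)
    (hv : ∀ ε > (0 : ℝ), ∃ N : ℕ, ∀ q ≥ N, ∀ t ∈ Icc 0 T, ∀ x, ‖v q t x - u t x‖ ≤ ε)
    (hp : ∀ ε > (0 : ℝ), ∃ N : ℕ, ∀ q ≥ N, ∀ t ∈ Icc 0 T, ∀ x, ‖p q t x - P t x‖ ≤ ε)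
    (hR : ∀ ε > (0 : ℝ), ∃ N : ℕ, ∀ q ≥ N, ∀ t ∈ Icc 0 T, ∀ x, ‖R q t x‖ ≤ ε)
    (hκ : ∀ ε > (0 : ℝ), ∃ N : ℕ, ∀ q ≥ N, ∀ t ∈ Icc 0 T, ∀ x, ‖κ q t x‖ ≤ ε)
    (hφ : ∀ ε > (0 : ℝ), ∃ N : ℕ, ∀ q ≥ N, ∀ t ∈ Icc 0 T, ∀ x, ‖φ q t x‖ ≤ ε) :
    FunctionSpaces.Torus.kineticEnergy (u T) - FunctionSpaces.Torus.kineticEnergy (u 0) =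
      2⁻¹ * (E T - E 0) := by
  have hE1 : ContDiff ℝ 1 E := (h 0).contDiff_one_energyLoss
  have hE'c : Continuous (deriv E) := hE1.continuous_deriv le_rfl
  have hD : ContinuousOn (fun t => -(2⁻¹ * deriv E t)) (Icc 0 T) :=
    (continuous_const.mul hE'c).neg.continuousOn
  have huc : ContinuousOn (FunctionSpaces.Torus.stLift u) (Icc 0 T ×ˢ univ) :=
    continuousOn_stLift_of_unifLimit (fun q => (h q).smooth_velocity.continuousOn_stLift) hv
  obtain ⟨-, hbal⟩ := IsDissipativeEulerReynoldsOn.unifLimit_isGloballyDissipativeEulerOn hT h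
    hE' hv hp hR hκ hφ
  have hid := kineticEnergy_sub_eq_neg_setIntegral_of_localEnergyBalance hT huc hD hbal
  rw [hid]
  -- `-∫_{(0,T)} (-(E'/2)) = (E(T) - E(0))/2` by the fundamental theorem of calculus
  have hFTC : ∫ t in Ioo 0 T, deriv E t = E T - E 0 := by
    rw [← integral_Ioc_eq_integral_Ioo, ← intervalIntegral.integral_of_le hT.le]
    exact intervalIntegral.integral_deriv_eq_sub (fun t _ => (hE1.differentiable one_ne_zero) t)
      (hE'c.intervalIntegrable _ _)
  have hint : Integrable (fun t => deriv E t) (volume.restrict (Ioo 0 T)) :=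
    (hE'c.integrableOn_Icc (a := 0) (b := T)).mono_set Ioo_subset_Icc_self
  rw [MeasureTheory.integral_neg, neg_neg, MeasureTheory.integral_const_mul, hFTC]

/-- **De Lellis–Kwon 2022, Thm. 1.1, from the output of the iteration** (§2.2–2.3 of the printed
proof). Let `0 < T` and let `(v_q, p_q, R_q, κ_q, φ_q)` be dissipative Euler–Reynolds flows on
`[0,T] × T^3` (Def. 2.1) with a common smooth energy loss `E`, `E' ≤ 0` on `[0,T]` and
`E(T) < E(0)` (DLK §2.3: `E(t) = -δ₁(1 - e^{-δ₀^{1/2} t})`), such that `v_q → u`, `p_q → P`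
uniformly, `(R_q, κ_q, φ_q) → 0` uniformly on `[0,T] × T^3` (the conclusion of iterating
Prop. 2.3, via (2.10)), and the limit velocity is of class `C^β([0,T] × T^3)`. Then `(u, P)`
witnesses the conclusion of `Torus.DeLellisKwon2022_thm11` for this `β` and `T`: a globally
dissipative Euler flow in `C^β` whose total kinetic energy strictly drops,
`½∫|u(T)|² < ½∫|u(0)|²`. The named fact itself follows once such a sequence is produced for every
`β < 1/7` and `T > 0` — the content of DLK Prop. 2.3 with the starting tuple of §2.3, which is not
formalised here. [cite: DelellisKwon2022, Thm. 1.1 (proof, §2.3)] -/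
theorem deLellisKwon2022_thm11_witness_of_iteration {β : ℝ≥0} {T : ℝ} (hT : 0 < T)
    {v : ℕ → ℝ → UnitAddTorus (Fin 3) → EuclideanSpace ℝ (Fin 3)}
    {p : ℕ → ℝ → UnitAddTorus (Fin 3) → ℝ}
    {R : ℕ → ℝ → UnitAddTorus (Fin 3) → Fin 3 → EuclideanSpace ℝ (Fin 3)}
    {κ : ℕ → ℝ → UnitAddTorus (Fin 3) → ℝ}
    {φ : ℕ → ℝ → UnitAddTorus (Fin 3) → EuclideanSpace ℝ (Fin 3)} {E : ℝ → ℝ}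
    {u : ℝ → UnitAddTorus (Fin 3) → EuclideanSpace ℝ (Fin 3)} {P : ℝ → UnitAddTorus (Fin 3) → ℝ}
    (h : ∀ q, IsDissipativeEulerReynoldsOn (Icc 0 T) (v q) (p q) (R q) (κ q) (φ q) E)
    (hE' : ∀ t ∈ Icc 0 T, deriv E t ≤ 0) (hET : E T < E 0)
    (hv : ∀ ε > (0 : ℝ), ∃ N : ℕ, ∀ q ≥ N, ∀ t ∈ Icc 0 T, ∀ x, ‖v q t x - u t x‖ ≤ ε)
    (hp : ∀ ε > (0 : ℝ), ∃ N : ℕ, ∀ q ≥ N, ∀ t ∈ Icc 0 T, ∀ x, ‖p q t x - P t x‖ ≤ ε)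
    (hR : ∀ ε > (0 : ℝ), ∃ N : ℕ, ∀ q ≥ N, ∀ t ∈ Icc 0 T, ∀ x, ‖R q t x‖ ≤ ε)
    (hκ : ∀ ε > (0 : ℝ), ∃ N : ℕ, ∀ q ≥ N, ∀ t ∈ Icc 0 T, ∀ x, ‖κ q t x‖ ≤ ε)
    (hφ : ∀ ε > (0 : ℝ), ∃ N : ℕ, ∀ q ≥ N, ∀ t ∈ Icc 0 T, ∀ x, ‖φ q t x‖ ≤ ε)
    (hHolder : FunctionSpaces.HolderOnSpaceTime β T u) :
    ∃ (u' : ℝ → UnitAddTorus (Fin 3) → EuclideanSpace ℝ (Fin 3))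
      (p' : ℝ → UnitAddTorus (Fin 3) → ℝ),
      IsGloballyDissipativeEulerOn T u' p' ∧ FunctionSpaces.HolderOnSpaceTime β T u' ∧
        FunctionSpaces.Torus.kineticEnergy (u' T) < FunctionSpaces.Torus.kineticEnergy (u' 0) := by
  refine ⟨u, P, (IsDissipativeEulerReynoldsOn.unifLimit_isGloballyDissipativeEulerOn hT h hE'
    hv hp hR hκ hφ).1, hHolder, ?_⟩
  have hsub := IsDissipativeEulerReynoldsOn.unifLimit_kineticEnergy_sub hT h hE' hv hp hR hκ hφ
  nlinarith

end Literature.Analysis.FluidPDE.Torus
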